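import Mathlib.NumberTheory.NumberField.ClassNumber
import Mathlib.GroupTheory.SpecificGroups.Cyclic
import HarnessLib

/-!
# Certificates for subgroups of the class group of a number field (odd class number)

A full class-number computation is rarely needed by arithmetic applications; what the complete
`2`-descents of `Literature/Barriers/BirchSwinnertonDyer/RankNotSumOfLocalInvariantsF3Cubic*`
need is `Cl(K)[2] = 0`, i.e. an ODD class number, for cubic fields whose class number is a
non-trivial power of `3`. This file packages the standard certificate (Marcus, Ch. 5, discussion
after Thm. 37; Mathlib's
`RingOfIntegers.isPrincipalIdealRing_of_isPrincipal_of_pow_le_of_mem_primesOver_of_mem_Icc` with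
"principal" replaced by "class in a given subgroup `H`"). PROVED:

* `ClassIn H I` (the class of `I` lies in `H`), multiplicative, trivial on principal ideals, and
  inherited from the prime factors (`ClassIn.of_prime_factors`);
* `classGroup_eq_top_of_classIn`: if every prime `P` above a rational prime `p ≤ ⌊M_K⌋`
  (Minkowski bound) with `p ^ f_P ≤ ⌊M_K⌋` has `ClassIn H P`, then `H = ⊤`;
* `ClassIn.of_mem_of_absNorm` (**relations**): if `β ∈ P`, `|N(β)| = N(P) · m` with `m > 0`, and
  every prime `Q` with `N(Q) ∣ m` has `ClassIn H Q`, then `ClassIn H P` (`(β) = P · J`, `N(J) = m`);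
* `mk0_pow_eq_one_of_forall_mem_imp_eq` (**orders**): if `β ∈ P`, `|N(β)| = N(P)^k` and `P` is
  the only prime containing `β`, then `[P]^k = 1` (`(β) = P^k`);
* `odd_classNumber_of_closure_eq_top`: if `Cl(K)` is generated by classes `s` with `s³ = 1`, the
  class number is odd, and then `isPrincipal_of_sq` : `𝔞² principal ⟹ 𝔞 principal`.

## References

* D. A. Marcus, *Number Fields*, 2nd ed. (2018), Ch. 5, Thm. 35–37 and the discussion following
  Thm. 37 (class-group computations from the Minkowski bound). [cite: Marcus2018, Ch. 5, Thm. 37]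
-/

noncomputable section

open scoped NumberField nonZeroDivisors Real

open Module NumberField InfinitePlace Ideal Nat UniqueFactorizationMonoid

namespace Literature.NumberTheory.NumberFields

variable {K : Type*} [Field K] [NumberField K]

/-- The Minkowski bound `M_K = (4/π)^{r₂} (n!/nⁿ) √|d_K|` (Mathlib's local notation in
`Mathlib/NumberTheory/NumberField/ClassNumber.lean`, repeated verbatim). -/
local notation "M " K:70 => (4 / π) ^ nrComplexPlaces K *
  ((finrank ℚ K)! / (finrank ℚ K) ^ (finrank ℚ K) * √|discr K|)

/-! ### Classes of products -/

/-- The predicate "the class of `I` lies in `H`" (vacuous for `I = ⊥`). [folklore] -/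
def ClassIn (H : Subgroup (ClassGroup (𝓞 K))) (I : Ideal (𝓞 K)) : Prop :=
  ∀ hI : I ∈ (Ideal (𝓞 K))⁰, ClassGroup.mk0 ⟨I, hI⟩ ∈ H

/-- `ClassIn H` is multiplicative. [folklore] -/
theorem ClassIn.mul {H : Subgroup (ClassGroup (𝓞 K))} {I J : Ideal (𝓞 K)} (hI : ClassIn H I)
    (hJ : ClassIn H J) : ClassIn H (I * J) := by
  intro hIJ
  have hI0 : I ∈ (Ideal (𝓞 K))⁰ := mem_nonZeroDivisors_of_ne_zero fun h =>
    nonZeroDivisors.ne_zero hIJ (by rw [h]; exact zero_mul J)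
  have hJ0 : J ∈ (Ideal (𝓞 K))⁰ := mem_nonZeroDivisors_of_ne_zero fun h =>
    nonZeroDivisors.ne_zero hIJ (by rw [h]; exact mul_zero I)
  have : (⟨I * J, hIJ⟩ : (Ideal (𝓞 K))⁰) = ⟨I, hI0⟩ * ⟨J, hJ0⟩ := rfl
  rw [this, map_mul]
  exact H.mul_mem (hI hI0) (hJ hJ0)

/-- From `ClassIn H (I J)` and `ClassIn H J` to `ClassIn H I` (`J ≠ ⊥`). [folklore] -/
theorem ClassIn.of_mul {H : Subgroup (ClassGroup (𝓞 K))} {I J : Ideal (𝓞 K)} (hIJ : ClassIn H (I * J))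
    (hJ : ClassIn H J) (hJ0 : J ≠ ⊥) : ClassIn H I := by
  intro hI0
  have hJ0' : J ∈ (Ideal (𝓞 K))⁰ := mem_nonZeroDivisors_of_ne_zero hJ0
  have hIJ0 : I * J ∈ (Ideal (𝓞 K))⁰ := mul_mem hI0 hJ0'
  have e : (⟨I * J, hIJ0⟩ : (Ideal (𝓞 K))⁰) = ⟨I, hI0⟩ * ⟨J, hJ0'⟩ := rfl
  have h := hIJ hIJ0
  rw [e, map_mul] at h
  have := H.mul_mem h (H.inv_mem (hJ hJ0'))
  rwa [mul_inv_cancel_right] at this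

/-- `ClassIn H ⊤`. [folklore] -/
theorem ClassIn.top (H : Subgroup (ClassGroup (𝓞 K))) : ClassIn H (⊤ : Ideal (𝓞 K)) := by
  intro h
  have : (⟨⊤, h⟩ : (Ideal (𝓞 K))⁰) = 1 := Subtype.ext (by rw [OneMemClass.coe_one, one_eq_top])
  rw [this, map_one]; exact H.one_mem

/-- A principal ideal has `ClassIn H`. [folklore] -/
theorem ClassIn.span_singleton (H : Subgroup (ClassGroup (𝓞 K))) (x : 𝓞 K) :
    ClassIn H (span {x}) := by
  intro h
  rw [(ClassGroup.mk0_eq_one_iff h).mpr ⟨⟨x, rfl⟩⟩]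
  exact H.one_mem

/-- A multiset product of ideals with `ClassIn H` has `ClassIn H`. [folklore] -/
theorem ClassIn.multiset_prod {H : Subgroup (ClassGroup (𝓞 K))} (s : Multiset (Ideal (𝓞 K)))
    (hs : ∀ J ∈ s, ClassIn H J) : ClassIn H s.prod := by
  induction s using Multiset.induction_on with
  | empty => simpa using ClassIn.top H
  | cons J s ih =>
    rw [Multiset.prod_cons]
    exact (hs J (Multiset.mem_cons_self J s)).mul
      (ih fun J' hJ' => hs J' (Multiset.mem_cons_of_mem hJ'))

/-- **`ClassIn H` from the prime factors**: if every prime factor of `I ≠ ⊥` has `ClassIn H`, so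
does `I`. [folklore] -/
theorem ClassIn.of_prime_factors {H : Subgroup (ClassGroup (𝓞 K))} {I : Ideal (𝓞 K)} (hI : I ≠ ⊥)
    (h : ∀ Q : Ideal (𝓞 K), Q.IsPrime → Q ≠ ⊥ → Q ∣ I → ClassIn H Q) : ClassIn H I := by
  rw [← Ideal.prod_normalizedFactors_eq_self hI]
  refine ClassIn.multiset_prod _ fun J hJ => ?_
  have hJp : J.IsPrime := isPrime_of_prime (prime_of_normalized_factor J hJ)
  have hJ0 : J ≠ ⊥ := (prime_of_normalized_factor J hJ).ne_zero
  exact h J hJp hJ0 (dvd_of_mem_normalizedFactors hJ)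

/-! ### Generation from the Minkowski bound -/

/-- **The class group is generated by the primes below the Minkowski bound** (relative to `H`):
if every prime `P` above a rational prime `p ∈ [1, ⌊M_K⌋]` with `p ^ f_P ≤ ⌊M_K⌋` has
`ClassIn H P`, then `H` is the whole class group (Mathlib's PID criterion
`isPrincipalIdealRing_of_isPrincipal_of_pow_le_of_mem_primesOver_of_mem_Icc` with "principal"
replaced by "class in `H`"). [cite: Marcus2018, Ch. 5, Thm. 37] -/
theorem classGroup_eq_top_of_classIn {H : Subgroup (ClassGroup (𝓞 K))}
    (h : ∀ p ∈ Finset.Icc 1 ⌊M K⌋₊, p.Prime → ∀ (P : Ideal (𝓞 K)),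
      P ∈ primesOver (span {(p : ℤ)}) (𝓞 K) → p ^ P.inertiaDeg ℤ ≤ ⌊M K⌋₊ →
      ClassIn H P) : H = ⊤ := by
  -- primes of norm `≤ M K` (Mathlib's bookkeeping, verbatim)
  have hprime : ∀ (P : Ideal (𝓞 K)) (HP : P ∈ (Ideal (𝓞 K))⁰), P.IsPrime →
      (absNorm P : ℝ) ≤ M K → ClassIn H P := by
    intro P HP hP hPN
    obtain ⟨p, hp⟩ := IsPrincipalIdealRing.principal <| under ℤ P
    have hp0 : p ≠ 0 := fun h' ↦ nonZeroDivisors.coe_ne_zero ⟨P, HP⟩ <|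
      eq_bot_of_comap_eq_bot (R := ℤ) <| by
        simpa only [hp, submodule_span_eq, span_singleton_eq_bot]
    have hpprime := (span_singleton_prime hp0).mp
    simp only [← submodule_span_eq, ← hp] at hpprime
    have hlies : P.LiesOver (span {p}) := by
      rcases abs_choice p with h' | h' <;>
      simpa [h', span_singleton_neg p, ← submodule_span_eq, ← hp] using over_under P
    have hspan : span {↑p.natAbs} = span {p} := by
      rcases abs_choice p with h' | h' <;> simp [h']
    have hple : p.natAbs ^ P.inertiaDeg ℤ ≤ ⌊M K⌋₊ := by
      refine Nat.le_floor ?_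
      have : P.IsMaximal := hP.isMaximal (by simpa using HP.2)
      have : (span {p}).IsMaximal := (hpprime (.under ℤ P)).isMaximal_span_singleton
      simpa only [hspan, ← Nat.cast_pow, ← natAbs_pow_inertiaDeg p P] using hPN
    have hpabsprime := Int.prime_iff_natAbs_prime.mp (hpprime (hP.under _))
    refine h _ ?_ hpabsprime _ ⟨hP, ?_⟩ hple
    · suffices 0 < P.inertiaDeg ℤ by
        exact Finset.mem_Icc.mpr ⟨hpabsprime.one_le, le_trans (Nat.le_pow this) hple⟩
      have := (isPrime_of_prime (prime_span_singleton_iff.mpr <|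
        hpprime (hP.under _))).isMaximal <| by simp [((hpprime (hP.under _))).ne_zero]
      exact inertiaDeg_pos ..
    · exact hspan ▸ hlies
  -- ideals of norm `≤ M K`
  have hideal : ∀ (I : (Ideal (𝓞 K))⁰), (absNorm (I : Ideal (𝓞 K)) : ℝ) ≤ M K →
      ClassIn H I := by
    intro I hI
    refine ClassIn.of_prime_factors (nonZeroDivisors.coe_ne_zero I) fun Q hQ hQ0 hdvd => ?_
    refine hprime Q (mem_nonZeroDivisors_of_ne_zero hQ0) hQ ?_
    exact (Nat.cast_le.mpr <| Nat.le_of_dvd (absNorm_pos_of_nonZeroDivisors I) <|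
      absNorm_dvd_absNorm_of_le <| le_of_dvd hdvd).trans hI
  -- every class has such a representative
  refine (Subgroup.eq_top_iff' H).mpr fun C => ?_
  obtain ⟨I, rfl, hI⟩ := exists_ideal_in_class_of_norm_le C
  have := hideal I hI I.2
  simpa using this

/-! ### Relations and orders from norms -/

/-- The absolute norm of a principal ideal. [folklore] -/
theorem absNorm_span_singleton' (x : 𝓞 K) :
    absNorm (span {x}) = (Algebra.norm ℤ x).natAbs := absNorm_span_singleton x

/-- Non-zero prime ideals of `𝓞 K` have absolute norm `> 1`. [folklore] -/
theorem one_lt_absNorm {P : Ideal (𝓞 K)} (hP : P.IsPrime) (hP0 : P ≠ ⊥) : 1 < absNorm P := by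
  have h1 : absNorm P ≠ 1 := fun h => hP.ne_top (absNorm_eq_one_iff.mp h)
  have h0 : absNorm P ≠ 0 := fun h => hP0 (absNorm_eq_zero_iff.mp h)
  omega

/-- **A relation from a norm**: if `β ∈ P`, `P ≠ ⊥`, `|N(β)| = N(P) · m` with `m > 0`, and every
non-zero prime `Q` with `N(Q) ∣ m` has `ClassIn H Q`, then `ClassIn H P`: `(β) = P · J` with
`N(J) = m`, all prime factors of `J` have norm dividing `m`, and `[P] = [J]⁻¹`.
[cite: Marcus2018, Ch. 5, Thm. 37] -/
theorem ClassIn.of_mem_of_absNorm {H : Subgroup (ClassGroup (𝓞 K))} {P : Ideal (𝓞 K)}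
    (hP0 : P ≠ ⊥) {β : 𝓞 K} (hβ : β ∈ P) {m : ℕ} (hm : 0 < m)
    (hnorm : (Algebra.norm ℤ β).natAbs = absNorm P * m)
    (hH : ∀ Q : Ideal (𝓞 K), Q.IsPrime → Q ≠ ⊥ → absNorm Q ∣ m → ClassIn H Q) : ClassIn H P := by
  obtain ⟨J, hJ⟩ : P ∣ span {β} := dvd_iff_le.mpr ((span_singleton_le_iff_mem P).mpr hβ)
  have hPn : absNorm P ≠ 0 := fun h => hP0 (absNorm_eq_zero_iff.mp h)
  have hβ0 : β ≠ 0 := by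
    rintro rfl
    rw [Algebra.norm_zero, Int.natAbs_zero] at hnorm
    exact Nat.mul_ne_zero hPn hm.ne' hnorm.symm
  have hsp0 : span {β} ≠ ⊥ := by rwa [Ne, span_singleton_eq_bot]
  have hJ0 : J ≠ ⊥ := by
    rintro rfl
    rw [mul_bot] at hJ
    exact hsp0 hJ
  have hJn : absNorm J = m := by
    have h := congrArg absNorm hJ
    rw [map_mul, absNorm_span_singleton, hnorm] at h
    exact (Nat.eq_of_mul_eq_mul_left (Nat.pos_of_ne_zero hPn) h).symm
  have hJc : ClassIn H J := ClassIn.of_prime_factors hJ0 fun Q hQ hQ0 hdvd =>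
    hH Q hQ hQ0 (hJn ▸ absNorm_dvd_absNorm_of_le (le_of_dvd hdvd))
  have hPJ : ClassIn H (P * J) := hJ ▸ ClassIn.span_singleton H β
  exact ClassIn.of_mul hPJ hJc hJ0

/-- **The order of a class from a norm**: if `β ∈ P` (`P` a non-zero prime), `|N(β)| = N(P)^k`,
and `P` is the only prime ideal containing `β`, then `(β) = P^k` and `[P]^k = 1`.
[cite: Marcus2018, Ch. 5, Thm. 37] -/
theorem mk0_pow_eq_one_of_forall_mem_imp_eq {P : Ideal (𝓞 K)} (hP : P.IsPrime) (hP0 : P ≠ ⊥)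
    {β : 𝓞 K} {k : ℕ} (hnorm : (Algebra.norm ℤ β).natAbs = absNorm P ^ k)
    (honly : ∀ Q : Ideal (𝓞 K), Q.IsPrime → Q ≠ ⊥ → β ∈ Q → Q = P)
    (hP0' : P ∈ (Ideal (𝓞 K))⁰) : ClassGroup.mk0 ⟨P, hP0'⟩ ^ k = 1 := by
  have hPn := one_lt_absNorm hP hP0
  have hβ0 : β ≠ 0 := by
    rintro rfl
    rw [Algebra.norm_zero, Int.natAbs_zero] at hnorm
    exact pow_ne_zero k (by omega : absNorm P ≠ 0) hnorm.symm
  have hsp0 : span {β} ≠ ⊥ := by rwa [Ne, span_singleton_eq_bot]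
  -- all prime factors of `(β)` are `P`
  set n := Multiset.card (normalizedFactors (span {β})) with hn
  have hfac : normalizedFactors (span {β}) = Multiset.replicate n P := by
    refine Multiset.eq_replicate.mpr ⟨rfl, fun Q hQ => ?_⟩
    have hQp : Q.IsPrime := isPrime_of_prime (prime_of_normalized_factor Q hQ)
    have hQ0 : Q ≠ ⊥ := (prime_of_normalized_factor Q hQ).ne_zero
    refine honly Q hQp hQ0 ?_
    exact (span_singleton_le_iff_mem Q).mp (le_of_dvd (dvd_of_mem_normalizedFactors hQ))
  have hspan : span {β} = P ^ n := by
    rw [← Ideal.prod_normalizedFactors_eq_self hsp0, hfac, Multiset.prod_replicate]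
  have hnk : n = k := by
    have h := congrArg absNorm hspan
    rw [absNorm_span_singleton, hnorm, map_pow] at h
    exact (Nat.pow_right_injective hPn h).symm
  have hval : ((⟨P, hP0'⟩ ^ k : (Ideal (𝓞 K))⁰) : Ideal (𝓞 K)) = span {β} := by
    rw [SubmonoidClass.coe_pow, hspan, hnk]
  rw [← map_pow, (ClassGroup.mk0_eq_one_iff _).mpr]
  rw [hval]
  exact ⟨⟨β, rfl⟩⟩

/-! ### Odd class number -/

/-- **An abelian group generated by elements of exponent `3` has odd order**: if the class group
is generated by classes `s` with `s³ = 1`, the class number is odd. [folklore] -/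
theorem odd_classNumber_of_closure_eq_top {S : Set (ClassGroup (𝓞 K))}
    (hgen : Subgroup.closure S = ⊤) (hS : ∀ s ∈ S, s ^ 3 = 1) : Odd (classNumber K) := by
  have hall : ∀ c : ClassGroup (𝓞 K), c ^ 3 = 1 := by
    intro c
    have hc : c ∈ Subgroup.closure S := hgen ▸ Subgroup.mem_top c
    induction hc using Subgroup.closure_induction with
    | mem x hx => exact hS x hx
    | one => exact one_pow 3
    | mul x y _ _ hx hy => rw [mul_pow, hx, hy, one_mul]
    | inv x _ hx => rw [inv_pow, hx, inv_one]
  by_contra hodd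
  rw [Nat.not_odd_iff_even, even_iff_two_dvd, classNumber] at hodd
  haveI : Fact (Nat.Prime 2) := ⟨Nat.prime_two⟩
  obtain ⟨c, hc⟩ := exists_prime_orderOf_dvd_card 2 hodd
  have h2 : c ^ 2 = 1 := hc ▸ pow_orderOf_eq_one c
  have h3 := hall c
  have hc1 : c = 1 := by
    calc c = c ^ 3 * (c ^ 2)⁻¹ := by group
      _ = 1 := by rw [h3, h2, inv_one, one_mul]
  rw [hc1, orderOf_one] at hc
  exact absurd hc (by norm_num)

/-- **`Cl(K)[2] = 0` for odd class number**: `𝔞²` principal implies `𝔞` principal. [folklore] -/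
theorem isPrincipal_of_sq_isPrincipal (hodd : Odd (classNumber K)) {I : Ideal (𝓞 K)}
    (hI : (I ^ 2).IsPrincipal) : I.IsPrincipal := by
  rcases eq_or_ne I ⊥ with rfl | hI0
  · exact bot_isPrincipal
  have hI0' : I ∈ (Ideal (𝓞 K))⁰ := mem_nonZeroDivisors_of_ne_zero hI0
  have hsq : ClassGroup.mk0 ⟨I, hI0'⟩ ^ 2 = 1 := by
    rw [← map_pow, ClassGroup.mk0_eq_one_iff]
    simpa only [SubmonoidClass.coe_pow] using hI
  have h1 : orderOf (ClassGroup.mk0 ⟨I, hI0'⟩) ∣ 2 := orderOf_dvd_of_pow_eq_one hsq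
  have h2 : orderOf (ClassGroup.mk0 ⟨I, hI0'⟩) ∣ classNumber K := orderOf_dvd_card
  have h12 : orderOf (ClassGroup.mk0 ⟨I, hI0'⟩) ∣ Nat.gcd 2 (classNumber K) := Nat.dvd_gcd h1 h2
  rw [(Nat.coprime_two_left.mpr hodd).gcd_eq_one, Nat.dvd_one, orderOf_eq_one_iff] at h12
  exact (ClassGroup.mk0_eq_one_iff hI0').mp h12

end Literature.NumberTheory.NumberFields

end
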